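import Literature.NumberTheory.EllipticCurves.Kato2004.TorsionNonscalarWitnessProofs
import Literature.NumberTheory.EllipticCurves.PointDivisibilityProofs
import HarnessLib

/-!
# A unipotent element on `E[9]` gives a witness fixing `E[3]` and non-scalar on `E[9]`; hence the
# `3`-adic tower from surj(3) + ONE unipotent non-trivial element of determinant `1` on `E[9]`
# (cell `b2b-bsdres`, team n1011, seat p14 gen 2 — row T-b9x 'EXOTIC corner at 9', step (B) of
# `cells/n1011/skel/T-b9x-nine.md`; pure algebra, no reduction hypothesis)

HONEST FRAMING (cell `b2b-bsdres`, run/shared/lean/b2b/bsd-rank1-residual/, verbatim in every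
file): the goal of the cell is to DELETE the COMBINATION-SHAPED residual classes of the
Birch–Swinnerton-Dyer formula for ALL analytic-rank `≤ 1` elliptic curves over `ℚ` — "full BSD
formula for every rank `≤ 1` curve in class `C`" assembled STRICTLY from published theorems — so
that the rank-`≤ 1` remainder becomes exactly the CONSTRUCTION-SHAPED classes, which are TYPED
(missing-input `Prop`s), NOT attempted. This is not "finishing BSD". Team n1011 (N10 / N11):
research route; no claim beyond the stated classes; labels UNCHANGED; nothing is booked. Theorems
only (no definition, no named fact).

## What this file proves

Let `E = W/ℚ` be an elliptic curve and `τ ∈ Γ_ℚ` act on `E[9]` UNIPOTENTLY OF ORDER TWO: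
`τ(τQ − Q) = τQ − Q` for all `Q ∈ E[9]` (i.e. `(τ − 1)² = 0`; this is how inertia at a
multiplicative prime `ℓ ≠ 3` acts, tree `smul_smul_sub_eq_of_mem_inertia_of_hasMultiplicativeReductionAt`),
NON-TRIVIALLY (`τQ ≠ Q` for some `Q ∈ E[9]`), and suppose the only scalars `1 + 3m` through which
`τ` could act on `E[9]` have `3 ∣ m` (automatic when `det ρ̄_{E,9}(τ) = 1`, e.g. for inertia at
`ℓ ≠ 3`).  Then

* `exists_fixing_three_nonscalar_nine_of_unipotent` — some `σ ∈ {τ, τ³}` fixes `E[3]` pointwise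
  and does NOT act on `E[9]` as a scalar `1 + 3m`: writing `N = τ − 1` (so `N² = 0`, `τ³ = 1 + 3N`
  on `E[9]`), if `3N ≠ 0` take `σ = τ³` (a relation `3N = 3m` on `E[9]` forces `m·(3NQ₀) = 0 =
  3·(3NQ₀)`, so `3NQ₀ = 0` whether or not `3 ∣ m`), else `σ = τ` (`τ` fixes `E[3] = 3·E[9]`, and
  a scalar `1 + 3m` with `3 ∣ m` is `1` on `E[9]`);
* `towerSurj_three_of_surj_of_unipotent_nine` — with `ρ̄_{E,3}` onto, `ρ̄_{E,3ⁿ}` is onto for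
  every `n` (n1011-p02's torsion-level Serre lifting lemma
  `forall_hasSurjectiveModNGaloisRep_three_pow_of_fixing_torsion_of_nonscalar`, p252833).

This is the algebraic half of the criterion "surj(3) ∧ a multiplicative prime `ℓ ≠ 3` with
`9 ∤ v_ℓ(Δ_min)` ⟹ the `3`-adic tower" (row T-b9x); the arithmetic half (inertia at `ℓ` moves a
point of `E[9]` when `9 ∤ v_ℓ(Δ_min)`) is step (A).  Nothing booked; no label change.

References: [SerreAbelianLadic1968] Ch. IV §3.4 Lemma 3 (IV-23) and A.1.2 (inertia at a
multiplicative place acts through `(1 *; 0 1)`); [Elkies2006] N. D. Elkies, arXiv:math/0612734, §1.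
-/

noncomputable section

open scoped Classical

open WeierstrassCurve Literature.NumberTheory.EllipticCurves

namespace Summit.BirchSwinnertonDyer.Rank1Residual.GaloisImage

variable (W : WeierstrassCurve ℚ) [W.IsElliptic]

omit [W.IsElliptic] in
/-- `E[n]` is `Γ_ℚ`-stable. [folklore] -/
private theorem smul_mem_geomTorsion' {n : ℤ} (σ : Field.absoluteGaloisGroup ℚ) {P : W.geomPoints}
    (hP : P ∈ geomTorsion W n) : σ • P ∈ geomTorsion W n :=
  Literature.NumberTheory.EllipticCurves.smul_mem_torsionBy σ hP

omit [W.IsElliptic] in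
/-- Membership in `E[n]` as an equation. [folklore] -/
private theorem zsmul_eq_zero_of_mem' {n : ℤ} {P : W.geomPoints} (hP : P ∈ geomTorsion W n) :
    n • P = 0 :=
  (Submodule.mem_torsionBy_iff _ _).mp hP

omit [W.IsElliptic] in
/-- Membership in `E[n]` from the equation. [folklore] -/
private theorem mem_of_zsmul_eq_zero' {n : ℤ} {P : W.geomPoints} (hP : n • P = 0) :
    P ∈ geomTorsion W n :=
  (Submodule.mem_torsionBy_iff _ _).mpr hP

/-- **A unipotent element on `E[9]` yields a witness fixing `E[3]` and non-scalar on `E[9]`.**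
Let `τ ∈ Γ_ℚ` satisfy `τ(τQ − Q) = τQ − Q` on `E[9]`, move some point of `E[9]`, and act on
`E[9]` as a scalar `1 + 3m` only if `3 ∣ m`.  Then some `σ` (namely `τ³` or `τ`) fixes `E[3]`
pointwise and is not a scalar `1 + 3m` on `E[9]` — the hypotheses `h1`, `hns` of
`forall_hasSurjectiveModNGaloisRep_of_fixing_torsion_of_nonscalar`.
[cite: SerreAbelianLadic1968, Ch. IV §3.4, Lemma 3 (IV-23) and A.1.2] -/
theorem exists_fixing_three_nonscalar_nine_of_unipotent (τ : Field.absoluteGaloisGroup ℚ)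
    (hU : ∀ Q ∈ geomTorsion W 9, τ • (τ • Q - Q) = τ • Q - Q)
    (hM : ∃ Q ∈ geomTorsion W 9, τ • Q ≠ Q)
    (hD : ∀ m : ℕ, (∀ Q ∈ geomTorsion W 9, τ • Q = (1 + 3 * m) • Q) → 3 ∣ m) :
    ∃ σ : Field.absoluteGaloisGroup ℚ, (∀ P ∈ geomTorsion W 3, σ • P = P) ∧
      ¬ ∃ m : ℕ, ∀ Q ∈ geomTorsion W 9, σ • Q = (1 + 3 * m) • Q := by
  -- bookkeeping on `E[9]`
  have h9 : ∀ Q ∈ geomTorsion W 9, (9 : ℕ) • Q = 0 := fun Q hQ ↦ by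
    have h := zsmul_eq_zero_of_mem' W hQ
    rwa [show (9 : ℤ) = ((9 : ℕ) : ℤ) by norm_num, natCast_zsmul] at h
  have h3of9 : ∀ Q ∈ geomTorsion W 9, ∀ m : ℕ, 3 ∣ m → (3 * m) • Q = 0 := by
    intro Q hQ m ⟨k, hk⟩
    rw [hk, show 3 * (3 * k) = k * 9 by ring, mul_smul, h9 Q hQ, smul_zero]
  have hmem3 : ∀ P ∈ geomTorsion W 3, P ∈ geomTorsion W 9 := fun P hP ↦ by
    apply mem_of_zsmul_eq_zero' W
    rw [show (9 : ℤ) = 3 * 3 by norm_num, mul_smul, zsmul_eq_zero_of_mem' W hP, smul_zero]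
  -- `τ (k • X) = k • τ X`
  have hτn : ∀ (k : ℕ) (X : W.geomPoints), τ • (k • X) = k • (τ • X) := fun k X ↦ smul_comm τ k X
  -- `τ³ Q = Q + 3 (τ Q - Q)` on `E[9]`
  have hτ3 : ∀ Q ∈ geomTorsion W 9, τ ^ 3 • Q = Q + (3 : ℕ) • (τ • Q - Q) := by
    intro Q hQ
    set N := τ • Q - Q with hNdef
    have hN : τ • N = N := hU Q hQ
    have e : τ • Q = Q + N := by rw [hNdef]; abel
    have h2 : τ ^ 2 • Q = Q + (2 : ℕ) • N := by
      rw [pow_two, mul_smul, e, smul_add, hN, e]; abel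
    rw [pow_succ', mul_smul, h2, smul_add, hτn 2 N, hN, e]; abel
  by_cases hA : ∃ Q ∈ geomTorsion W 9, (3 : ℕ) • (τ • Q - Q) ≠ 0
  · -- CASE A: `3N ≠ 0`; take `σ = τ³`
    obtain ⟨Q₀, hQ₀, hNQ₀⟩ := hA
    refine ⟨τ ^ 3, fun P hP ↦ ?_, ?_⟩
    · -- `τ³` fixes `E[3]`
      have h3P : (3 : ℕ) • P = 0 := by
        have h := zsmul_eq_zero_of_mem' W hP
        rwa [show (3 : ℤ) = ((3 : ℕ) : ℤ) by norm_num, natCast_zsmul] at h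
      rw [hτ3 P (hmem3 P hP), smul_sub, ← hτn, h3P, smul_zero, sub_zero, add_zero]
    · -- `τ³` is not a scalar `1 + 3m` on `E[9]`
      rintro ⟨m, hm⟩
      -- the relation `3 (τ Q - Q) = (3m) Q` on `E[9]`
      have hrel : ∀ Q ∈ geomTorsion W 9, (3 : ℕ) • (τ • Q - Q) = (3 * m) • Q := by
        intro Q hQ
        have h := hm Q hQ
        rw [hτ3 Q hQ, add_smul, one_smul] at h
        exact add_left_cancel h
      -- applied to `N Q₀ ∈ E[9]`, where `N (N Q₀) = 0`
      have hNmem : τ • Q₀ - Q₀ ∈ geomTorsion W 9 :=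
        (geomTorsion W 9).sub_mem (smul_mem_geomTorsion' W τ hQ₀) hQ₀
      have hNN : τ • (τ • Q₀ - Q₀) - (τ • Q₀ - Q₀) = 0 := by rw [hU Q₀ hQ₀, sub_self]
      have h1 : (3 * m) • (τ • Q₀ - Q₀) = 0 := by rw [← hrel _ hNmem, hNN, smul_zero]
      -- so `m • X = 0` and `3 • X = 0` for `X = 3 (τ Q₀ - Q₀)`
      have hmX : m • ((3 : ℕ) • (τ • Q₀ - Q₀)) = 0 := by rw [← mul_smul, mul_comm, h1]
      have h3X : (3 : ℕ) • ((3 : ℕ) • (τ • Q₀ - Q₀)) = 0 := by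
        rw [← mul_smul, show (3 : ℕ) * 3 = 9 by norm_num, h9 _ hNmem]
      by_cases h3m : 3 ∣ m
      · -- the relation itself kills `3 N Q₀`
        exact hNQ₀ (by rw [hrel Q₀ hQ₀]; exact h3of9 Q₀ hQ₀ m h3m)
      · -- Bézout: `m b ≡ 1 (mod 3)`
        have hcop : Nat.Coprime m 3 :=
          ((Nat.Prime.coprime_iff_not_dvd Nat.prime_three).mpr h3m).symm
        obtain ⟨b, -, hb⟩ := Nat.exists_mul_mod_eq_one_of_coprime hcop (by norm_num)
        have hdm : 3 * (m * b / 3) + 1 = m * b := by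
          have := Nat.div_add_mod (m * b) 3
          rw [hb] at this
          exact this
        apply hNQ₀
        have key : (m * b) • ((3 : ℕ) • (τ • Q₀ - Q₀)) = (3 : ℕ) • (τ • Q₀ - Q₀) := by
          rw [← hdm, add_smul, one_smul, mul_comm 3 _, mul_smul, h3X, smul_zero, zero_add]
        rw [← key, mul_comm m b, mul_smul, hmX, smul_zero]
  · -- CASE B: `3N = 0`; take `σ = τ`
    push Not at hA
    refine ⟨τ, fun P hP ↦ ?_, ?_⟩
    · -- `τ` fixes `E[3] = 3 · E[9]`
      obtain ⟨Q, hQ⟩ := W.zsmul_geomPoints_surjective_holds (n := 3) (by norm_num) P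
      have hQz : (3 : ℤ) • Q = P := hQ
      have hQ' : (3 : ℕ) • Q = P := by
        rwa [show (3 : ℤ) = ((3 : ℕ) : ℤ) by norm_num, natCast_zsmul] at hQz
      have hQ9 : Q ∈ geomTorsion W 9 := by
        apply mem_of_zsmul_eq_zero' W
        have hQz' : (3 : ℤ) • Q = P := hQ
        rw [show (9 : ℤ) = 3 * 3 by norm_num, mul_smul, hQz']
        exact zsmul_eq_zero_of_mem' W hP
      have h := hA Q hQ9
      rw [smul_sub, ← hτn, sub_eq_zero] at h
      rw [← hQ']
      exact h
    · rintro ⟨m, hm⟩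
      obtain ⟨Q, hQ, hne⟩ := hM
      exact hne (by rw [hm Q hQ, add_smul, one_smul, h3of9 Q hQ m (hD m hm), add_zero])

/-- **The `3`-adic tower from surj(3) and ONE unipotent element of determinant one on `E[9]`.**
If `ρ̄_{E,3}` is onto and some `τ ∈ Γ_ℚ` acts on `E[9]` with `(τ − 1)² = 0`, non-trivially, and
through a scalar `1 + 3m` only when `3 ∣ m` (e.g. `det ρ̄_{E,9}(τ) = 1`), then `ρ̄_{E,3ⁿ}` is onto
for every `n` (`exists_fixing_three_nonscalar_nine_of_unipotent` + n1011-p02's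
`forall_hasSurjectiveModNGaloisRep_three_pow_of_fixing_torsion_of_nonscalar`).  Inertia at a
multiplicative prime `ℓ ≠ 3` with `9 ∤ v_ℓ(Δ_min)` supplies such a `τ` (row T-b9x, step (A)).
[cite: SerreAbelianLadic1968, Ch. IV §3.4, Lemma 3 (IV-23) and A.1.2] [cite: Elkies2006, §1] -/
theorem towerSurj_three_of_surj_of_unipotent_nine (hsurj : W.HasSurjectiveModNGaloisRep 3)
    (τ : Field.absoluteGaloisGroup ℚ)
    (hU : ∀ Q ∈ geomTorsion W 9, τ • (τ • Q - Q) = τ • Q - Q)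
    (hM : ∃ Q ∈ geomTorsion W 9, τ • Q ≠ Q)
    (hD : ∀ m : ℕ, (∀ Q ∈ geomTorsion W 9, τ • Q = (1 + 3 * m) • Q) → 3 ∣ m) (n : ℕ) :
    W.HasSurjectiveModNGaloisRep (3 ^ n : ℕ) := by
  obtain ⟨σ, h1, hns⟩ := exists_fixing_three_nonscalar_nine_of_unipotent W τ hU hM hD
  exact W.forall_hasSurjectiveModNGaloisRep_three_pow_of_fixing_torsion_of_nonscalar hsurj σ h1 hns n

end Summit.BirchSwinnertonDyer.Rank1Residual.GaloisImage

end
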